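import Summits.Langlands.Langlands.Statement
import HarnessLib

/-!
# On-path lemma (F4) for the rung `RegularTotallyRealA 3` of line `RegularTotallyRealA3`
# (crux `ReciprocityUpToIrreducibility`, item stmt-Langlands-14328)

`Langlands → RegularTotallyRealA n` for every `0 < n` (so in particular for the rung `n = 3` and for
every further rung): clause (A) of the summit at any reciprocity datum — one exists by the `Nonempty`
conjunct of the revised Statement (p141787) — with irreducibility and uniqueness dropped.  The rung
family is VERBATIM the one of `Lines/RegularTotallyRealA3.lean` / `Lines/RegularTotallyRealA3_special.lean`.
Sorry-free; std axioms.  (The [nec]-trap is discharged by the F3 witness: the other end of the ladder is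
pinned to the proved Hilbert floor `n = 2`.)
-/

noncomputable section

set_option linter.dupNamespace false

open scoped MatrixGroups Matrix NumberField Classical Polynomial
open Filter IsDedekindDomain Field Polynomial
open Literature.NumberTheory.Automorphic Literature.NumberTheory.GaloisRepresentations
open Literature.NumberTheory.PAdicHodge
open Summit.Langlands

namespace Summit.Langlands.Langlands.Cruxes.ReciprocityUpToIrreducibility.RegularTotallyRealA3.OnPath

/-- Rung family, verbatim `Lines/RegularTotallyRealA3.lean` `RegularTotallyRealA`. -/
def RegularTotallyRealA (n : ℕ) : Prop :=
  ∀ (K : Type) [Field K] [NumberField K], NumberField.IsTotallyReal K →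
    ∃ Rec : ReciprocityData K,
      ∀ (hcpt : isCompact_glFiniteIntegralLevel n K) (π : CuspidalAutomorphicRepData n K hcpt),
        π.1.IsLAlgebraic → (∃ T : InfinityType K n, π.1.HasInfinityType T ∧ T.IsRegular) →
        ∀ (ℓ : ℕ) [Fact ℓ.Prime] (ι : PadicAlgCl ℓ ≃+* ℂ),
          ∃ ρ : FramedGaloisRep K (PadicAlgCl ℓ) n, IsGeometricFramed Rec ρ ∧ Corresponds Rec ι π.1 ρ

/-- **Dial monotonicity in the summit direction**: the summit gives every rung. -/
theorem regularTotallyRealA_of_langlands {n : ℕ} (hn : 0 < n) (hL : _root_.Langlands) :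
    RegularTotallyRealA n := by
  intro K _ _ _hK
  obtain ⟨⟨Rec⟩, hall⟩ := hL K
  refine ⟨Rec, fun hcpt π hLalg _ ℓ _ ι => ?_⟩
  have hA : AutomorphicToGalois n Rec hcpt := (hall Rec n hn hcpt).1
  obtain ⟨ρ, -, hgeo, hcorr, -⟩ := hA π hLalg ℓ ι
  exact ⟨ρ, hgeo, hcorr⟩

/-- **F4 on-path lemma for the rung**: `Langlands → RegularTotallyRealA 3`. -/
@[aesop safe apply]
theorem RegularTotallyRealA3_of_Langlands (hL : _root_.Langlands) : RegularTotallyRealA 3 :=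
  regularTotallyRealA_of_langlands (by norm_num) hL

end Summit.Langlands.Langlands.Cruxes.ReciprocityUpToIrreducibility.RegularTotallyRealA3.OnPath

end
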